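import Mathlib
import HarnessLib
import Literature.MathematicalPhysics.StatisticalMechanics.PolymerProductSplit
import Literature.MathematicalPhysics.StatisticalMechanics.RenormalisationMapP2Fluct

/-!
# `R_{k+1}[P₂(e^{−H},K)(X)] = R K(X) + R(e^{−H}−1)^X + R[rest(X)]` for the torus data ([ABKM19] Ch. 9.1)

The inner split `P₂(X) = K(X) + (e^{−H}−1)^X + Σ_{∅≠Y⊊X}(e^{−H}−1)^{X∖Y}K(Y)`
(`PolymerProductSplit.polyP2_eq_add_add_rest`) is pushed through the fluctuation integral `R_{k+1}`: each
of the three pieces is `T_k^{X*}`-local, `C^{r₀}` and bounded in `|·|_{T_k^{X*}, w_k^X}`, hence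
`μ_{k+1}`-integrable along every section `φ + ·` (`ActivitySpace.integrable_comp_add_of_tayNormLE` with
`StepOperatorBABKM.weightSectionDominated_abkm`), so `R` is additive on them.  This is the
integrability plumbing of step (e1) of the crux line's Lipschitz assembly: in
`RenormalisationMapSplit.nextKStep_eq_split` the `X₁ = ∅` factor `R[P₂(X)]` now reads
`R K(X) + R(e^{−H}−1)^X + R[rest(X)]`, exposing the linear pieces `R K(X)` (→ `largePart`, or the
single-block `blockTerm` via `FirstOrderCancellationBlock`) and `R(e^{−H}−1)^X`.

* `tayNormLE_bprod_expNegH_sub_one_abkm` — `|(e^{−H}−1)^X|_{T_k^{X*}, w_k^X} ≤ (8e^{1/4}‖H‖_{k,0})^{|X|_k}`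
  (strong weights `∏_B W_k^B ≤ w_k^X`);
* `tayNormLE_apply_abkm` — `|K(X)|_{T_k^{X*}, w_k^X} ≤ ∏_{Y∈𝓒(X)} C A^{−|Y|_k}` on ANY `k`-polymer (Lemma 8.3 (i));
* **`fluct_polyP2_eq_add_add_rest_abkm`** — the displayed identity, for non-empty `k`-polymers `X`.

Everything is proved; no named fact.

## References
* S. Adams, S. Buchholz, R. Kotecký, S. Müller, arXiv:1910.13564, Ch. 9.1 (R₁ is linear), Lemma 8.3,
  Lemma 9.4 [AdamsBuchholzKoteckyMuller2019].
-/

noncomputable section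

namespace Literature.MathematicalPhysics.StatisticalMechanics.GradientRG

open scoped BigOperators Classical
open Finset Matrix MeasureTheory
open Literature.MathematicalPhysics.StatisticalMechanics.TorusPolymer
  (IsPolymer Separated blocks polys bprod blockOf thicken mem_polys mem_blocks isPolymer_blockOf)
open Literature.Barriers.CriticalPhenomena.LongRangePhi4.Polymer (IsConn components)
open Literature.MathematicalPhysics.QuantumFieldTheory

variable {d M : ℕ} [NeZero M]

/-- **`|(e^{−H}−1)^X|_{T_k^{X*}, w_k^X} ≤ ∏_{B ∈ 𝓑_k(X)} 8e^{1/4}‖H‖_{k,0}`** for a `k`-polymer `X` and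
`‖H‖_{k,0} ≤ ⅛` (torus tower; the product of the strong weights is dominated by `w_k^X`, (w5)).
[cite: AdamsBuchholzKoteckyMuller2019, Lemma 9.3 (9.16) / Theorem 7.1 (w5)] -/
theorem tayNormLE_bprod_expNegH_sub_one_abkm {L N Mord R n p r₀ : ℕ} {θbar lam μ δ₁ δ₀ A𝒫 h A : ℝ}
    {𝒞 : ℕ → (Fin d → ZMod M) → ℝ} (hd : 2 ≤ d) (hLodd : Odd L)
    (hM : M = L ^ N) {k : ℕ} (hkN : k + 1 ≤ N) (hp : d / 2 + 1 ≤ p) (hMord : d / 2 + 1 ≤ Mord)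
    (hB : AbkmWeightBounds L N Mord R n θbar lam μ δ₁ δ₀ A𝒫 𝒞
      (abkmWeightData L N Mord R θbar (schedDelta δ₀ δ₁ N) 𝒞))
    (hδ₀ : 0 < δ₀) (hδ₁ : 0 < δ₁) (hh : 0 < h) (hh0 : hZeroSq d R δ₀ δ₁ ≤ h ^ 2)
    {X : Finset (Fin d → ZMod M)} (hX : IsPolymer (L ^ k) X)
    {H : RelevantHamiltonian ℂ d}
    (hH : hamNorm (fieldWt h (L : ℝ) d k) ((L : ℝ) ^ k) (L ^ (d * k)) H ≤ 1 / 8) :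
    TayNormLE ((abkmNormParams L N Mord R p r₀ h θbar A (schedDelta δ₀ δ₁ N) 𝒞).gauge k X) r₀
      ((abkmWeightData L N Mord R θbar (schedDelta δ₀ δ₁ N) 𝒞).weight k X)
      (fun φ => bprod (L ^ k) (fun B => expNegH H B φ - 1) X)
      (∏ _B ∈ blocks (L ^ k) X,
        8 * Real.exp (1 / 4) * hamNorm (fieldWt h (L : ℝ) d k) ((L : ℝ) ^ k) (L ^ (d * k)) H) := by
  set P := abkmNormParams L N Mord R p r₀ h θbar A (schedDelta δ₀ δ₁ N) 𝒞 with hP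
  set W := abkmWeightData L N Mord R θbar (schedDelta δ₀ δ₁ N) 𝒞 with hW
  set s := L ^ k with hs
  have hkN' : k ≤ N := by omega
  have hL0 : (0 : ℝ) < L := by exact_mod_cast hLodd.pos
  obtain ⟨t, ht⟩ : ∃ t, N = k + t := ⟨N - k, by omega⟩
  have hMt : M = s * L ^ t := by rw [hs, ← pow_add, ← ht]; exact hM
  have htodd : Odd (L ^ t) := hLodd.pow
  have hsodd : Odd s := hLodd.pow
  have h𝔥 : 0 < P.𝔥 k := fieldWt_pos hh hL0 d k
  have hR : 0 < P.R k := by show (0 : ℝ) < (L : ℝ) ^ k; positivity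
  set G : ℕ → Finset (Fin d → ZMod M) → Matrix (Fin d → ZMod M) (Fin d → ZMod M) ℝ :=
    fun j Y => strongCoef h N j • derivForm (L : ℝ) j (diffIndex d Mord)
      (boxDensity (boxRad R L j) (boxWt (L : ℝ) d j) Y) with hG
  have hGs : W.StrongDominated G fun _ X Y => Disjoint X Y :=
    hB.strong (diffIndex d Mord) (fun α hα => hα) (strongCoef h N) (strongCoef_le hδ₀ hδ₁ hh hh0)
  have hcard : ∀ x, (blockOf s x).card = L ^ (d * k) := fun x => by
    rw [TorusPolymer.card_blockOf hMt hsodd htodd x, hs, ← pow_mul, mul_comm]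
  have hnn : 0 ≤ hamNorm (fieldWt h (L : ℝ) d k) ((L : ℝ) ^ k) (L ^ (d * k)) H :=
    hamNorm_nonneg (fieldWt_pos hh hL0 d k).le (by positivity) _ H
  have hF : ∀ B ∈ blocks s X, TayNormLE (P.gauge k B) r₀ (expWeight (G k B))
      (fun ψ => expNegH H B ψ - 1)
      (8 * Real.exp (1 / 4) * hamNorm (fieldWt h (L : ℝ) d k) ((L : ℝ) ^ k) (L ^ (d * k)) H) := by
    intro B hBm
    obtain ⟨x, -, rfl⟩ := mem_blocks.1 hBm
    have hH' : hamNorm (fieldWt h (L : ℝ) d k) ((L : ℝ) ^ k) (blockOf s x).card H ≤ 1 / 8 := by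
      rw [hcard x]; exact hH
    have := tayNormLE_expNegH_sub_one_strong_abkm (R := R) (N := N) (Mord := Mord) hd hLodd hM hkN' hh
      hMord hp (TorusPolymer.subset_thicken (P.rad k) (blockOf s x)) r₀ hH'
    rw [hcard x] at this
    exact this
  have hFd : ∀ B ∈ blocks s X, ContDiff ℝ r₀ (fun ψ : (Fin d → ZMod M) → ℝ => expNegH H B ψ - 1) :=
    fun B _ => ((contDiff_eval H B (n := r₀)).neg.cexp).sub contDiff_const
  have hFloc : ∀ B ∈ blocks s X, IsGaugeLocal (P.gauge k B)
      (fun ψ : (Fin d → ZMod M) → ℝ => expNegH H B ψ - 1) := fun B _ =>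
    IsGaugeLocal.op₁ _ (fun z : ℂ => z - 1) (isGaugeLocal_cexp_neg_eval h𝔥.ne' hR.ne' hp
      (TorusPolymer.subset_thicken _ _) H)
  have hleb : ∀ B ∈ blocks s X, ∀ ξ, ‖P.gauge k B ξ‖ ≤ ‖P.gauge k X ξ‖ := fun B hBm =>
    norm_fieldGauge_mono_set _ _ _ (TorusPolymer.thicken_mono _ (hX.subset_of_mem_blocks hBm))
  have ha : ∀ B ∈ blocks s X, (0 : ℝ) ≤
      8 * Real.exp (1 / 4) * hamNorm (fieldWt h (L : ℝ) d k) ((L : ℝ) ^ k) (L ^ (d * k)) H :=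
    fun _ _ => by positivity
  have h1 := tayNormLE_bprod s (P.gauge k X) (fun B => P.gauge k B) X hF hleb hFd hFloc ha
  -- `∏_B W_k^B ≤ w_k^X` ((w5) with `Y = ∅`)
  have hw : ∀ φ, (∏ B ∈ blocks s X, expWeight (G k B) φ) ≤ W.weight k X φ := fun φ => by
    have h := weight_mul_prod_strongWeight_le hB.dominated hB.monotone hGs k s hX
      (TorusPolymer.isPolymer_empty s) (empty_subset X) φ
    have hw0 : W.weight k ∅ φ = 1 := by
      have hwU : ∀ X' Y', IsPolymer s X' → IsPolymer s Y' → Separated (s + 1) X' Y' →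
          ∀ φ, W.weight k (X' ∪ Y') φ = W.weight k X' φ * W.weight k Y' φ := fun X' Y' _ _ hsep φ =>
        WeightData.weight_union hB.dominated hB.isLocal hB.additive (k := k) hsep φ
      exact weight_empty_of_union hwU (fun φ => W.weight_pos k ∅ φ) φ
    rwa [sdiff_empty, hw0, mul_one] at h
  exact h1.mono_weight (prod_nonneg ha) hw

/-- **`|K(X)|_{T_k^{X*}, w_k^X} ≤ ∏_{Y ∈ 𝓒(X)} C A^{−|Y|_k}` on any `k`-polymer `X`** for a factorising
activity with `K(∅) = 1`, local on connected polymers, `‖K‖_k^{(A)} ≤ C` (Lemma 8.3 (i) for the torus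
tower, weights multiplicative over separated components). [cite: AdamsBuchholzKoteckyMuller2019, Lemma 8.3 (i)] -/
theorem tayNormLE_apply_abkm {L N Mord R n p r₀ : ℕ} {θbar lam μ δ₁ δ₀ A𝒫 h A : ℝ}
    {𝒞 : ℕ → (Fin d → ZMod M) → ℝ} (hLodd : Odd L) (hM : M = L ^ N) {k : ℕ} (hkN : k ≤ N)
    (hB : AbkmWeightBounds L N Mord R n θbar lam μ δ₁ δ₀ A𝒫 𝒞
      (abkmWeightData L N Mord R θbar (schedDelta δ₀ δ₁ N) 𝒞)) (hA : 0 < A)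
    {X : Finset (Fin d → ZMod M)} (hX : IsPolymer (L ^ k) X)
    {K : Finset (Fin d → ZMod M) → ((Fin d → ZMod M) → ℝ) → ℂ} {C : ℝ} (hC : 0 ≤ C)
    (hK : WeakNormLE (abkmNormParams L N Mord R p r₀ h θbar A (schedDelta δ₀ δ₁ N) 𝒞) k K C)
    (hKfac : Factorises (L ^ k) K) (hK0 : ∀ φ, K ∅ φ = 1) (hKd : ∀ Y, ContDiff ℝ r₀ (K Y))
    (hKloc : ∀ Y, IsPolymer (L ^ k) Y → IsConn Y →
      IsGaugeLocal ((abkmNormParams L N Mord R p r₀ h θbar A (schedDelta δ₀ δ₁ N) 𝒞).gauge k Y) (K Y)) :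
    TayNormLE ((abkmNormParams L N Mord R p r₀ h θbar A (schedDelta δ₀ δ₁ N) 𝒞).gauge k X) r₀
      ((abkmWeightData L N Mord R θbar (schedDelta δ₀ δ₁ N) 𝒞).weight k X) (K X)
      (∏ Z ∈ components X, C * (abkmNormParams L N Mord R p r₀ h θbar A (schedDelta δ₀ δ₁ N) 𝒞).aFactor k Z) := by
  set P := abkmNormParams L N Mord R p r₀ h θbar A (schedDelta δ₀ δ₁ N) 𝒞 with hP
  set W := abkmWeightData L N Mord R θbar (schedDelta δ₀ δ₁ N) 𝒞 with hW
  set s := L ^ k with hs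
  obtain ⟨t, ht⟩ : ∃ t, N = k + t := ⟨N - k, by omega⟩
  have hMt : M = s * L ^ t := by rw [hs, ← pow_add, ← ht]; exact hM
  have htodd : Odd (L ^ t) := hLodd.pow
  have hsodd : Odd s := hLodd.pow
  have hMo : Odd M := by rw [hM]; exact hLodd.pow
  have hwU : ∀ X' Y', IsPolymer s X' → IsPolymer s Y' → Separated (s + 1) X' Y' →
      ∀ φ, W.weight k (X' ∪ Y') φ = W.weight k X' φ * W.weight k Y' φ := fun X' Y' _ _ hsep φ =>
    WeightData.weight_union hB.dominated hB.isLocal hB.additive (k := k) hsep φ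
  have hw0 : ∀ φ, W.weight k ∅ φ = 1 := weight_empty_of_union hwU (fun φ => W.weight_pos k ∅ φ)
  have hsubZ : ∀ {Z : Finset (Fin d → ZMod M)}, Z ∈ components X → Z ⊆ X := fun {Z} hZ => by
    rw [Literature.Barriers.CriticalPhenomena.LongRangePhi4.Polymer.eq_biUnion_components X]
    exact Finset.subset_biUnion_of_mem id hZ
  refine tayNormLE_of_factorises hMt hsodd htodd (P.gauge k X) (fun Z => P.gauge k Z) hwU hw0 hKfac hK0 hX
    (fun Z hZ => ?_) (fun Z hZ ξ => ?_) (fun Z _ => hKd Z) (fun Z hZ => ?_) (fun Z _ => ?_)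
  · obtain ⟨hZp, hZc⟩ := TorusPolymer.IsPolymer.of_mem_components hMo hsodd hX hZ
    exact hK Z hZp hZc
  · exact norm_fieldGauge_mono_set _ _ _ (TorusPolymer.thicken_mono _ (hsubZ hZ)) ξ
  · obtain ⟨hZp, hZc⟩ := TorusPolymer.IsPolymer.of_mem_components hMo hsodd hX hZ
    exact hKloc Z hZp hZc
  · exact mul_nonneg hC (WeakNormLE.aFactor_pos hA k Z).le

/-- **`R_{k+1}[P₂(e^{−H},K)(X)] = R K(X) + R(e^{−H}−1)^X + R[Σ_{∅≠Y⊊X}(e^{−H}−1)^{X∖Y}K(Y)]`** for a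
non-empty `k`-polymer `X` and the torus data (`θ̄, λ > 0`, `AbkmWeightBounds`, `‖H‖_{k,0} ≤ ⅛`,
`‖K‖_k^{(A)} ≤ C`, `K` factorising with `K(∅) = 1`, local, `C^{r₀}`): the three pieces are integrable
along every section, so the fluctuation integral is additive on them.
[cite: AdamsBuchholzKoteckyMuller2019, Ch. 9.1 (R₁ linear) / Lemma 8.4] -/
theorem fluct_polyP2_eq_add_add_rest_abkm {L N Mord R n p r₀ : ℕ} {θbar lam μ δ₁ δ₀ A𝒫 h A : ℝ}
    {𝒞 : ℕ → (Fin d → ZMod M) → ℝ} (hd : 2 ≤ d) (hLodd : Odd L)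
    (hM : M = L ^ N) {k : ℕ} (hkN : k + 1 ≤ N) (hp : d / 2 + 1 ≤ p) (hMord : d / 2 + 1 ≤ Mord)
    (hθbar : 0 < θbar) (hlam : 0 < lam)
    (hB : AbkmWeightBounds L N Mord R n θbar lam μ δ₁ δ₀ A𝒫 𝒞
      (abkmWeightData L N Mord R θbar (schedDelta δ₀ δ₁ N) 𝒞))
    (hδ₀ : 0 < δ₀) (hδ₁ : 0 < δ₁) (hh : 0 < h) (hh0 : hZeroSq d R δ₀ δ₁ ≤ h ^ 2) (hA : 0 < A)
    {X : Finset (Fin d → ZMod M)} (hX : IsPolymer (L ^ k) X) (hXne : X.Nonempty)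
    {H : RelevantHamiltonian ℂ d}
    (hH : hamNorm (fieldWt h (L : ℝ) d k) ((L : ℝ) ^ k) (L ^ (d * k)) H ≤ 1 / 8)
    {K : Finset (Fin d → ZMod M) → ((Fin d → ZMod M) → ℝ) → ℂ} {C : ℝ} (hC : 0 ≤ C)
    (hK : WeakNormLE (abkmNormParams L N Mord R p r₀ h θbar A (schedDelta δ₀ δ₁ N) 𝒞) k K C)
    (hKfac : Factorises (L ^ k) K) (hK0 : ∀ φ, K ∅ φ = 1) (hKd : ∀ Y, ContDiff ℝ r₀ (K Y))
    (hKloc : ∀ Y, IsPolymer (L ^ k) Y → IsConn Y →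
      IsGaugeLocal ((abkmNormParams L N Mord R p r₀ h θbar A (schedDelta δ₀ δ₁ N) 𝒞).gauge k Y) (K Y))
    (φ : (Fin d → ZMod M) → ℝ) :
    fluct (𝒞 (k + 1)) (polyP2 (L ^ k) H K X) φ =
      fluct (𝒞 (k + 1)) (K X) φ + fluct (𝒞 (k + 1)) (fun ψ => bprod (L ^ k) (fun B => expNegH H B ψ - 1) X) φ +
        fluct (𝒞 (k + 1)) (fun ψ => ∑ Y ∈ ((polys (L ^ k) X).erase X).erase ∅,
          bprod (L ^ k) (fun B => expNegH H B ψ - 1) (X \ Y) * K Y ψ) φ := by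
  set P := abkmNormParams L N Mord R p r₀ h θbar A (schedDelta δ₀ δ₁ N) 𝒞 with hP
  set W := abkmWeightData L N Mord R θbar (schedDelta δ₀ δ₁ N) 𝒞 with hW
  set s := L ^ k with hs
  have hk1 : k + 1 ≤ N + 1 := by omega
  have hkN' : k ≤ N := by omega
  have hL0 : (0 : ℝ) < L := by exact_mod_cast hLodd.pos
  obtain ⟨t, ht⟩ : ∃ t, N = k + t := ⟨N - k, by omega⟩
  have hMt : M = s * L ^ t := by rw [hs, ← pow_add, ← ht]; exact hM
  have htodd : Odd (L ^ t) := hLodd.pow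
  have hsodd : Odd s := hLodd.pow
  have h𝔥 : 0 < P.𝔥 k := fieldWt_pos hh hL0 d k
  have hR : 0 < P.R k := by show (0 : ℝ) < (L : ℝ) ^ k; positivity
  have hdom := weightSectionDominated_abkm hθbar hlam hB hk1 X (P.gauge k X)
  have hnn : 0 ≤ hamNorm (fieldWt h (L : ℝ) d k) ((L : ℝ) ^ k) (L ^ (d * k)) H :=
    hamNorm_nonneg (fieldWt_pos hh hL0 d k).le (by positivity) _ H
  have haF : ∀ Z, 0 ≤ P.aFactor k Z := fun Z => (WeakNormLE.aFactor_pos hA k Z).le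
  -- (1) `K(X)`
  have hK1 := tayNormLE_apply_abkm (p := p) hLodd hM hkN' hB hA hX hC hK hKfac hK0 hKd hKloc
  have hK1loc : IsGaugeLocal (P.gauge k X) (K X) :=
    isGaugeLocal_of_factorises_polys hMt hsodd htodd hKfac hK0 hKloc hX
  have hiK : Integrable (fun ξ => K X (φ + ξ)) (stepMeasure (𝒞 (k + 1))) :=
    integrable_comp_add_of_tayNormLE hK1 (prod_nonneg fun Z _ => mul_nonneg hC (haF Z)) (hKd X) hK1loc hdom φ
  -- (2) `(e^{−H}−1)^X`
  have hE := tayNormLE_bprod_expNegH_sub_one_abkm (p := p) (r₀ := r₀) (A := A) hd hLodd hM hkN hp hMord hB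
    hδ₀ hδ₁ hh hh0 hX hH
  have hEd : ContDiff ℝ r₀ (fun ψ => bprod s (fun B => expNegH H B ψ - 1) X) := by
    unfold TorusPolymer.bprod
    exact contDiff_prod fun B _ => ((contDiff_eval H B (n := r₀)).neg.cexp).sub contDiff_const
  have hEloc : IsGaugeLocal (P.gauge k X) (fun ψ => bprod s (fun B => expNegH H B ψ - 1) X) := by
    unfold TorusPolymer.bprod
    refine IsGaugeLocal.prod _ fun B hB => ?_
    have hloc : IsGaugeLocal (P.gauge k B) (fun ψ : (Fin d → ZMod M) → ℝ => expNegH H B ψ - 1) :=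
      IsGaugeLocal.op₁ _ (fun z : ℂ => z - 1) (isGaugeLocal_cexp_neg_eval h𝔥.ne' hR.ne' hp
        (TorusPolymer.subset_thicken _ _) H)
    exact hloc.of_norm_le fun ξ =>
      norm_fieldGauge_mono_set _ _ _ (TorusPolymer.thicken_mono _ (hX.subset_of_mem_blocks hB)) ξ
  have hiE : Integrable (fun ξ => bprod s (fun B => expNegH H B (φ + ξ) - 1) X) (stepMeasure (𝒞 (k + 1))) :=
    integrable_comp_add_of_tayNormLE hE (prod_nonneg fun _ _ => by positivity) hEd hEloc hdom φ
  -- (3) the rest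
  set 𝓨 := ((polys s X).erase X).erase ∅ with h𝓨
  have h𝓨sub : 𝓨 ⊆ polys s X := (erase_subset _ _).trans (erase_subset _ _)
  have hRst := tayNormLE_polyP2Rest_abkm hd hLodd hM hkN hp hMord hB hδ₀ hδ₁ hh hh0 hA hX h𝓨sub hH hC hK
    hKfac hK0 hKd hKloc
  have hRd : ContDiff ℝ r₀ (fun ψ => ∑ Y ∈ 𝓨, bprod s (fun B => expNegH H B ψ - 1) (X \ Y) * K Y ψ) := by
    refine ContDiff.sum fun Y _ => ContDiff.mul ?_ (hKd Y)
    unfold TorusPolymer.bprod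
    exact contDiff_prod fun B _ => ((contDiff_eval H B (n := r₀)).neg.cexp).sub contDiff_const
  have hRloc : IsGaugeLocal (P.gauge k X)
      (fun ψ => ∑ Y ∈ 𝓨, bprod s (fun B => expNegH H B ψ - 1) (X \ Y) * K Y ψ) := by
    -- the rest is `P₂(X) − K(X) − (e^{−H}−1)^X`, all three local
    have hP2loc := isGaugeLocal_polyP2_abkm (Mord := Mord) (R := R) (r₀ := r₀) (θbar := θbar) (A := A)
      (δ := schedDelta δ₀ δ₁ N) (𝒞 := 𝒞) hLodd hM hkN' hh hp H hKfac hK0 hKloc hX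
    intro ψ ψ' e
    have h1 := hP2loc ψ ψ' e
    have h2 := hK1loc ψ ψ' e
    have h3 := hEloc ψ ψ' e
    rw [polyP2_eq_add_add_rest H hK0 hX hXne ψ, polyP2_eq_add_add_rest H hK0 hX hXne ψ'] at h1
    simp only at h3
    show ∑ Y ∈ 𝓨, bprod s (fun B => expNegH H B ψ - 1) (X \ Y) * K Y ψ =
      ∑ Y ∈ 𝓨, bprod s (fun B => expNegH H B ψ' - 1) (X \ Y) * K Y ψ'
    have := congrArg (fun z => z - K X ψ - bprod s (fun B => expNegH H B ψ - 1) X) h1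
    rw [h2, h3] at this
    have e4 : ∑ Y ∈ 𝓨, bprod s (fun B => expNegH H B ψ - 1) (X \ Y) * K Y ψ =
        K X ψ' + bprod s (fun B => expNegH H B ψ' - 1) X +
          ∑ Y ∈ 𝓨, bprod s (fun B => expNegH H B ψ - 1) (X \ Y) * K Y ψ - K X ψ' -
          bprod s (fun B => expNegH H B ψ' - 1) X := by ring
    rw [e4, this]; ring
  have hiR : Integrable (fun ξ => ∑ Y ∈ 𝓨, bprod s (fun B => expNegH H B (φ + ξ) - 1) (X \ Y) * K Y (φ + ξ))
      (stepMeasure (𝒞 (k + 1))) :=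
    integrable_comp_add_of_tayNormLE hRst (sum_nonneg fun Y _ => mul_nonneg (prod_nonneg fun _ _ => by positivity)
      (prod_nonneg fun Z _ => mul_nonneg hC (haF Z))) hRd hRloc hdom φ
  -- assemble
  unfold fluct
  have hsplit : ∀ ξ, polyP2 s H K X (φ + ξ) = K X (φ + ξ) + bprod s (fun B => expNegH H B (φ + ξ) - 1) X +
      ∑ Y ∈ 𝓨, bprod s (fun B => expNegH H B (φ + ξ) - 1) (X \ Y) * K Y (φ + ξ) := fun ξ =>
    polyP2_eq_add_add_rest H hK0 hX hXne (φ + ξ)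
  simp_rw [hsplit]
  have hiKE : Integrable (fun ξ => K X (φ + ξ) + bprod s (fun B => expNegH H B (φ + ξ) - 1) X)
      (stepMeasure (𝒞 (k + 1))) := hiK.add hiE
  rw [integral_add hiKE hiR, integral_add hiK hiE]

end Literature.MathematicalPhysics.StatisticalMechanics.GradientRG

end
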